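import Literature.NumberTheory.PAdicHodge.AinfWeierstrassKummerIntegralEta
import Literature.NumberTheory.PAdicHodge.KummerFilZeroCoboundaryCriterion
import Literature.NumberTheory.PAdicHodge.DeRhamOfTatePtPeriods
import Literature.NumberTheory.PAdicHodge.AinfWeierstrassHodgeTateNonvanishing
import Literature.NumberTheory.PAdicHodge.AinfWeierstrassEtaHasseWitness
import HarnessLib

/-!
# The Kummer cocycle of a RATIONAL formal point dies in `H¹(F, B_dR⁺ ⊗ V_pE)` — good supersingular reduction, modulo the
# Hodge–Tate and η-transversality witnesses

Topic `Literature/NumberTheory/PAdicHodge`; namespace `Literature.NumberTheory.PAdicHodge`. THEOREMS ONLY (no definition, no named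
fact, no instance, no `sorry`). CAPSTONE of brick K1 (floors 3–4) of the hT₂ programme of crux K★ `stmt-BirchSwinnertonDyer-22226`
(`Cruxes/StarredOptimalManinUnitFiveSeven/Lines/kato-lever-hT2-programme.md` §4, `…/kato-lever-K1-floor3.md`): it plugs

* the INTEGRATING PAIR `(b_ω ∈ Fil¹, b_η ∈ B_dR⁺)` of the Kummer cocycle `κ_u` of a `[p]`-division sequence `u` with a `Γ_F`-fixed
  lift `Q` of its base point (`AinfWeierstrassKummerIntegral{,Eta}`: `(σ−1)b_ω = ∫_{κ_u σ}ω`, `(σ−1)b_η = ∫_{κ_u σ}η`),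
* the matching `T_pE(F̄) ≃ T_pŴ(𝒪_{ℂ_F})` at an odd prime of good SUPERSINGULAR reduction (`tateGeomEquivTatePtSS`) and the bridge
  `B_dR⁺(F) → B_dR(F)` of `DeRhamOfTatePtPeriods`,
* and the basis-free criterion `isFilZeroCoboundary_rationalTateModule_of_periodHoms` (`KummerFilZeroCoboundaryCriterion`: periods detect
  coboundaries + `Fil⁰` by Legendre divisibility + Legendre transversality from Tate's theorem)

into **`isFilZeroCoboundary_kummerCocycle_curveF`**: for `W/ℤ` with `p ∤ Δ_W`, `p` odd, Hasse invariant `0` at `p`, a `p`-adic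
field `F`, the curve `E = W ×_ℤ F`, the Kummer cocycle `κ_u` read in `T_pE` through the matching is a `Fil⁰`-COBOUNDARY of
`B_dR(F) ⊗ V_pE`:
`(bdRPeriodRingData hp).IsFilZeroCoboundary (rationalTateRep E p) (σ ↦ 1 ⊗ toRational (e⁻¹ (κ_u σ)))` — the exact shape of the «⟸»
half of the cite-only (S5a) `expStarCoord_eq_zero_iff_kummer` — GIVEN the two non-degeneracy witnesses
(HT) `∃ τ, ∫_τ ω ∉ Fil²` (Tate's Hodge–Tate map `T_pŴ → ℂ_F(1)` is nonzero; Tate 1967 §4, NOT in the tree) and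
(Nη) `∃ τ, R_p(τ₁) ∉ p𝒪_{ℂ_F}` (tree dischargers `AinfWeierstrassEtaHasse*`, `…EtaTransversalityCells`).
Corollary `isFilZeroCoboundary_kummerCocycle_curveF_of_zp` for base points with parameter `p·c`, `c ∈ ℤ_p`.
**UNCONDITIONAL for `p ≥ 5`**: both witnesses are tree theorems — (HT) by `exists_omegaPeriodHom_not_mem_filOne_sq`
(`AinfWeierstrassHodgeTateNonvanishing`, Tate's Hodge–Tate nonvanishing via the tilt), (Nη) by `exists_tatePt_mulDefectC_not_mem`
(`AinfWeierstrassEtaHasseWitness`) — giving **`isFilZeroCoboundary_kummerCocycle_curveF_of_five_le`** and its `_of_zp` form: at a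
prime `p ≥ 5` of good supersingular reduction the Kummer cocycle of EVERY rational formal point dies in `H¹(F, B_dR⁺ ⊗ V_pE)`.

Not here: the descent `E(F) ⊋ Ê(𝔪_F)` (multiply by the index), ramified / additive `W` (potentially good reduction, as in
`DeRhamEllipticAbove`), `p ∈ {2, 3}`. BSD / K★ are not proved by any of this.

## References
* [BlochKato1990] S. Bloch, K. Kato (1990), Ex. 3.10.1, (3.11.1), Lemma 3.8.1.
* [Kato1993LNM1553] K. Kato, LNM 1553 (1993), Ch. II Lemma 1.4.3.
* [Tate1967] J. Tate, *p-divisible groups* (1967), §3.3, §4.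
* [Colmez1992PeriodesAbeliennes] P. Colmez, Math. Ann. 292 (1992), §2.
-/

noncomputable section

open scoped TensorProduct

namespace Literature.NumberTheory.PAdicHodge

open Literature Literature.NumberTheory.GaloisRepresentations Literature.NumberTheory.EllipticCurves WeierstrassCurve
open Literature.NumberTheory.GaloisRepresentations.IsNonarchimedeanLocalField Field ValuativeRel
open Literature.NumberTheory.GaloisRepresentations.LubinTate

variable {F : Type} [Field F] [ValuativeRel F] [TopologicalSpace F] [IsNonarchimedeanLocalField F] [CharZero F]
  {p : ℕ} [Fact p.Prime] [Fact (¬ IsUnit (p : integerC F))] [IsAdicComplete (Ideal.span {(p : integerC F)}) (integerC F)]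
  (hp : valuation F p < 1) [Algebra ℚ_[p] F]

/-- **Bridge, `Fil²`**: if the image of `y ∈ B_dR⁺` in `B_dR` lies in `Fil² = ξ²B_dR⁺`, then `y ∈ (ξ)²` in `B_dR⁺`
(`B_dR⁺ → B_dR` is injective). [cite: FontaineAsterisque223III, Exp. II §1.5.5] -/
theorem mem_sq_of_algebraMap_mem_fil_two (y : BdRPlusTop F p)
    (h : algebraMap (BDeRhamPlus (integerC F) p) (FracBdR F p) ((BdRPlusTop.of F p).symm y) ∈
      (bdRPeriodRingData (F := F) (p := p) hp).fil 2) :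
    y ∈ ((BdRPlusTop.filOne F p).toIdeal ^ 2 : Ideal (BdRPlusTop F p)) := by
  have hF := surjective_fontaineTheta_integerC hp
  haveI : IsDomain (BDeRhamPlus (integerC F) p) := isDomain_bDeRhamPlus hF
  letI : Algebra F (FracBdR F p) := fracAlgebra hp hF
  change _ ∈ fil hp hF 2 at h
  rw [mem_fil_iff] at h
  obtain ⟨b, hb⟩ := h
  rw [show (2 : ℤ) = ((2 : ℕ) : ℤ) from rfl, zpow_natCast, ← map_pow, ← map_mul] at hb
  have hb' := algebraMap_fracBdR_injective (F := F) (p := p) hb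
  have hy : y = BdRPlusTop.of F p (xiBdR ^ 2 * b) := by
    rw [← hb']; rfl
  rw [hy, map_mul, map_pow]
  change BdRPlusTop.of F p xiBdR ^ 2 * BdRPlusTop.of F p b ∈ ((BdRPlusTop.filOne F p).toIdeal ^ 2 : Ideal (BdRPlusTop F p))
  refine Ideal.mul_mem_right _ _ (Ideal.pow_mem_pow ?_ 2)
  change BdRPlusTop.of F p xiBdR ∈ (WithIdeal.i : Ideal (BdRPlusTop F p))
  rw [BdRPlusTop.ideal_eq]
  exact Ideal.mem_span_singleton_self _

/-- **CAPSTONE of K1 (good supersingular reduction): the Kummer cocycle of a rational formal point dies in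
`H¹(F, B_dR⁺ ⊗ V_pE)`**, modulo the Hodge–Tate witness (HT) and the η-transversality witness (Nη). `W/ℤ`, `p` odd, `p ∤ Δ_W`,
`A_p(W mod p) = 0`; `u` a `[p]`-division sequence of `Ŵ(𝔪_{ℂ_F})` with a `Γ_F`-fixed lift `Q ∈ Ŵ(𝔫)` of `u₀`; `E = W ×_ℤ F`,
`e : T_pE ≃ T_pŴ(𝒪_{ℂ_F})` the matching. Then
`(bdRPeriodRingData hp).IsFilZeroCoboundary (rationalTateRep E p) (σ ↦ 1 ⊗ toRational (e⁻¹ (κ_u σ)))`.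
[cite: BlochKato1990, Ex. 3.10.1, (3.11.1), Lemma 3.8.1] [cite: Kato1993LNM1553, Ch. II Lemma 1.4.3] [cite: Tate1967, §4] -/
theorem isFilZeroCoboundary_kummerCocycle_curveF (W : WeierstrassCurve ℤ) [(AinfTop.curveF F W).IsElliptic]
    (hp2 : p ≠ 2) (hΔ : ¬ (p : ℤ) ∣ W.Δ) (hA : (W.map (Int.castRingHom (ZMod p))).hasseCoeff p = 0)
    (hHT : ∃ τ : AinfTop.TatePt F p W, AinfTop.omegaPeriodHom W (surjective_fontaineTheta_integerC hp) τ ∉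
      ((BdRPlusTop.filOne F p).toIdeal ^ 2 : Ideal (BdRPlusTop F p)))
    (hNη : ∃ τ : AinfTop.TatePt F p W, AinfTop.mulDefectC W p (AinfTop.seq W τ 1) ∉ Ideal.span {(p : CBall F)})
    {u : ℕ → (maxNilIdealC F).toIdeal} (hup : ∀ n, AinfTop.mulPC F p W (u (n + 1)) = u n)
    {Q : W.Pt (AinfTop.nilTheta F p (surjective_fontaineTheta_integerC hp))}
    (hQ : AinfTop.thetaPt W (surjective_fontaineTheta_integerC hp) Q = ⟨u 0⟩)
    (hQσ : ∀ σ : absoluteGaloisGroup F, AinfTop.galPtN W (surjective_fontaineTheta_integerC hp) σ Q = Q) :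
    (bdRPeriodRingData (F := F) (p := p) hp).IsFilZeroCoboundary (rationalTateRep (AinfTop.curveF F W) p) fun σ =>
      ((1 : (bdRPeriodRingData (F := F) (p := p) hp).B) ⊗ₜ[ℚ_[p]]
        TateModule.toRational p ((AinfTop.tateGeomEquivTatePtSS F W p norm_natCast_C_lt_one' hp2 hΔ hA).symm
          (AinfTop.kummerCocycle W u hup (AinfTop.galCBall_base_eq_of_fixedLift W hQ hQσ) σ)) :
        (bdRPeriodRingData (F := F) (p := p) hp).B ⊗[ℚ_[p]] (AinfTop.curveF F W).rationalTateModule p) := by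
  have hF := surjective_fontaineTheta_integerC hp
  have hpC : ‖(p : CompletedAlgClosure F)‖ < 1 := norm_natCast_C_lt_one'
  have hpF : (p : F) ≠ 0 := Nat.cast_ne_zero.mpr (Fact.out : p.Prime).ne_zero
  haveI : Module.Finite ℚ_[p] ((AinfTop.curveF F W).rationalTateModule p) :=
    module_finite_rationalTateModule_holds (AinfTop.curveF F W) p
  -- rigidity of the `ℚ_p`-algebra structure of `F`
  have halg : ∀ c : ℚ_[p], algebraMap ℚ_[p] F c = LocalField.padicRingHom F p hp c := fun c =>
    RingHom.congr_fun (LocalField.ringHom_padic_ext _ _) c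
  -- the matching, the bridge `B_dR⁺ → B_dR`, the two period functionals on `T_pE`
  let e : (AinfTop.curveF F W).tateModule p ≃ₗ[ℤ_[p]] AinfTop.TatePt F p W :=
    AinfTop.tateGeomEquivTatePtSS F W p hpC hp2 hΔ hA
  let ιB : BdRPlusTop F p →+* (bdRPeriodRingData (F := F) (p := p) hp).B :=
    (algebraMap (BDeRhamPlus (integerC F) p) (FracBdR F p)).comp (BdRPlusTop.of F p).symm.toRingHom
  have hιB : ∀ y, ιB y = algebraMap (BDeRhamPlus (integerC F) p) (FracBdR F p) ((BdRPlusTop.of F p).symm y) :=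
    fun _ => rfl
  let φ₁ : (AinfTop.curveF F W).tateModule p →+ (bdRPeriodRingData (F := F) (p := p) hp).B :=
    ιB.toAddMonoidHom.comp ((AinfTop.omegaPeriodHom W hF).comp e.toAddMonoidHom)
  let φ₂ : (AinfTop.curveF F W).tateModule p →+ (bdRPeriodRingData (F := F) (p := p) hp).B :=
    ιB.toAddMonoidHom.comp ((AinfTop.etaPeriodHom W hF).comp e.toAddMonoidHom)
  have hφ₁ : ∀ a, φ₁ a = ιB (AinfTop.omegaPeriodHom W hF (e a)) := fun _ => rfl
  have hφ₂ : ∀ a, φ₂ a = ιB (AinfTop.etaPeriodHom W hF (e a)) := fun _ => rfl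
  -- dictionary: scalars, Galois, the matching
  have hsc : ∀ (c : ℤ_[p]) (y : BdRPlusTop F p),
      ιB (BdRPlusTop.of F p (qpToBdR (c : ℚ_[p])) * y) = (c : ℚ_[p]) • ιB y := fun c y => by
    rw [map_mul, Algebra.smul_def, PeriodRingData.algebraMap_eq]
    congr 1
    change algebraMap (BDeRhamPlus (integerC F) p) (FracBdR F p) (qpToBdR (c : ℚ_[p])) =
      algebraMap (BDeRhamPlus (integerC F) p) (FracBdR F p) (embBdRHom hp hF (algebraMap ℚ_[p] F c))
    rw [embBdRHom_algebraMap_padic hp hF halg]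
  have hgal : ∀ (σ : absoluteGaloisGroup F) (y : BdRPlusTop F p), ιB (BdRPlusTop.gal F p σ y) = σ • ιB y := fun σ y => by
    change _ = σ • algebraMap (BDeRhamPlus (integerC F) p) (FracBdR F p) ((BdRPlusTop.of F p).symm y)
    rw [smul_algebraMap_fracBdR]
    rfl
  have he : ∀ (σ : absoluteGaloisGroup F) (a : (AinfTop.curveF F W).tateModule p), e (σ • a) = σ • e a := fun σ a => by
    have h := AinfTop.tateGeomEquivTatePtSS_galois W p hpC hp2 hΔ hA σ a
    rwa [WeierstrassCurve.galoisRepTate_apply_apply, AinfTop.tatePtRep_apply_apply] at h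
  -- the integrating pair
  have hu₀ := AinfTop.galCBall_base_eq_of_fixedLift W hQ hQσ
  have hω : ∀ σ, BdRPlusTop.gal F p σ (AinfTop.bOmega W hup hQ) - AinfTop.bOmega W hup hQ =
      AinfTop.omegaPeriodHom W hF (AinfTop.kummerCocycle W u hup hu₀ σ) :=
    AinfTop.gal_bOmega_sub_bOmega_eq_omegaPeriodHom W hup hQ hQσ
  have hη : ∀ σ, BdRPlusTop.gal F p σ (AinfTop.bEta W hup hQ) - AinfTop.bEta W hup hQ =
      AinfTop.etaPeriodHom W hF (AinfTop.kummerCocycle W u hup hu₀ σ) :=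
    AinfTop.gal_bEta_sub_bEta_eq_etaPeriodHom W hup hQ hQσ
  -- feed the basis-free criterion
  refine isFilZeroCoboundary_rationalTateModule_of_periodHoms hp (rationalTateRep (AinfTop.curveF F W) p) (fun σ a => σ • a)
    (finrank_rationalTateModule_eq_two_holds (AinfTop.curveF F W) p hpF) (fun _ _ _ => rfl) φ₁ φ₂
    (fun c a => ?_) (fun c a => ?_) (fun σ a => ?_) (fun σ a => ?_) (fun a => ?_) (fun a => ?_) ?_ ?_
    (fun σ => e.symm (AinfTop.kummerCocycle W u hup hu₀ σ)) (b₁ := ιB (AinfTop.bOmega W hup hQ))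
    (b₂ := ιB (AinfTop.bEta W hup hQ)) ?_ ?_ (fun σ => ?_) (fun σ => ?_)
  · rw [hφ₁, hφ₁, LinearEquiv.map_smul, AinfTop.omegaPeriodHom_smul', hsc]
  · rw [hφ₂, hφ₂, LinearEquiv.map_smul, AinfTop.etaPeriodHom_smul', hsc]
  · rw [hφ₁, hφ₁, he, ← AinfTop.gal_omegaPeriodHom, hgal]
  · rw [hφ₂, hφ₂, he, ← AinfTop.gal_etaPeriodHom, hgal]
  · rw [hφ₁, hιB]
    exact (algebraMap_mem_fil_one_iff hp _).2 (AinfTop.omegaPeriodHom_mem_filOne W _)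
  · rw [hφ₂, hιB]
    have hF' := hF
    haveI : IsDomain (BDeRhamPlus (integerC F) p) := isDomain_bDeRhamPlus hF'
    letI : Algebra F (FracBdR F p) := fracAlgebra hp hF'
    exact algebraMap_mem_fil_zero hp hF' _
  · obtain ⟨τ, hτ⟩ := hHT
    refine ⟨e.symm τ, fun h => hτ ?_⟩
    rw [hφ₁, LinearEquiv.apply_symm_apply, hιB] at h
    exact mem_sq_of_algebraMap_mem_fil_two hp _ h
  · obtain ⟨τ, hτ⟩ := hNη
    refine ⟨e.symm τ, fun h => AinfTop.etaPeriodHom_not_mem_filOne W (hθ := hF) τ hτ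
      ((algebraMap_mem_fil_one_iff hp (AinfTop.etaPeriodHom W hF τ)).1 ?_)⟩
    rwa [hφ₂, LinearEquiv.apply_symm_apply, hιB] at h
  · rw [hιB]
    exact (algebraMap_mem_fil_one_iff hp _).2 (AinfTop.bOmega_mem_filOne W hup hQ)
  · rw [hιB]
    have hF' := hF
    haveI : IsDomain (BDeRhamPlus (integerC F) p) := isDomain_bDeRhamPlus hF'
    letI : Algebra F (FracBdR F p) := fracAlgebra hp hF'
    exact algebraMap_mem_fil_zero hp hF' _
  · rw [hφ₁, LinearEquiv.apply_symm_apply, ← hω σ, map_sub, hgal]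
  · rw [hφ₂, LinearEquiv.apply_symm_apply, ← hη σ, map_sub, hgal]

/-- **The same for `ℚ_p`-rational base points** (parameter `p·c`, `c ∈ ℤ_p`): the Kummer cocycle of a `[p]`-division sequence of a
`ℚ_p`-rational point of `Ŵ(pℤ_p)` dies in `H¹(F, B_dR⁺ ⊗ V_pE)` (good supersingular reduction, modulo (HT), (Nη)).
[cite: BlochKato1990, Ex. 3.10.1, (3.11.1)] [cite: Kato1993LNM1553, Ch. II Lemma 1.4.3] -/
theorem isFilZeroCoboundary_kummerCocycle_curveF_of_zp (W : WeierstrassCurve ℤ) [(AinfTop.curveF F W).IsElliptic]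
    (hp2 : p ≠ 2) (hΔ : ¬ (p : ℤ) ∣ W.Δ) (hA : (W.map (Int.castRingHom (ZMod p))).hasseCoeff p = 0)
    (hHT : ∃ τ : AinfTop.TatePt F p W, AinfTop.omegaPeriodHom W (surjective_fontaineTheta_integerC hp) τ ∉
      ((BdRPlusTop.filOne F p).toIdeal ^ 2 : Ideal (BdRPlusTop F p)))
    (hNη : ∃ τ : AinfTop.TatePt F p W, AinfTop.mulDefectC W p (AinfTop.seq W τ 1) ∉ Ideal.span {(p : CBall F)})
    {u : ℕ → (maxNilIdealC F).toIdeal} (hup : ∀ n, AinfTop.mulPC F p W (u (n + 1)) = u n) (c : ℤ_[p])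
    (hu0 : (u 0 : CBall F) = AinfTop.theta F p (AinfTop.of F p (zpToAinf ((p : ℤ_[p]) * c)))) :
    ∃ hu₀ : ∀ σ : absoluteGaloisGroup F, galCBall σ (u 0 : CBall F) = u 0,
      (bdRPeriodRingData (F := F) (p := p) hp).IsFilZeroCoboundary (rationalTateRep (AinfTop.curveF F W) p) fun σ =>
        ((1 : (bdRPeriodRingData (F := F) (p := p) hp).B) ⊗ₜ[ℚ_[p]]
          TateModule.toRational p ((AinfTop.tateGeomEquivTatePtSS F W p norm_natCast_C_lt_one' hp2 hΔ hA).symm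
            (AinfTop.kummerCocycle W u hup hu₀ σ)) :
          (bdRPeriodRingData (F := F) (p := p) hp).B ⊗[ℚ_[p]] (AinfTop.curveF F W).rationalTateModule p) := by
  have hQ : AinfTop.thetaPt W (surjective_fontaineTheta_integerC hp) (AinfTop.zpPt W (surjective_fontaineTheta_integerC hp) c) =
      ⟨u 0⟩ :=
    WeierstrassCurve.Pt.ext (Subtype.ext (by rw [AinfTop.coe_val_thetaPt, AinfTop.coe_val_zpPt, hu0]))
  exact ⟨AinfTop.galCBall_base_eq_of_fixedLift W hQ fun σ => AinfTop.galPtN_zpPt W σ c,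
    isFilZeroCoboundary_kummerCocycle_curveF hp W hp2 hΔ hA hHT hNη hup hQ fun σ => AinfTop.galPtN_zpPt W σ c⟩

/-- **UNCONDITIONAL CAPSTONE (`p ≥ 5`, good supersingular reduction): the Kummer cocycle of a rational formal point dies in
`H¹(F, B_dR⁺ ⊗ V_pE)`.** The witnesses (HT) and (Nη) of `isFilZeroCoboundary_kummerCocycle_curveF` are the tree theorems
`exists_omegaPeriodHom_not_mem_filOne_sq` (Tate's Hodge–Tate nonvanishing) and `exists_tatePt_mulDefectC_not_mem` (η-Hasse).
[cite: BlochKato1990, Ex. 3.10.1, (3.11.1), Lemma 3.8.1] [cite: Tate1967, §4] [cite: Kato1993LNM1553, Ch. II Lemma 1.4.3] -/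
theorem isFilZeroCoboundary_kummerCocycle_curveF_of_five_le (W : WeierstrassCurve ℤ) [(AinfTop.curveF F W).IsElliptic]
    (hp5 : 5 ≤ p) (hΔ : ¬ (p : ℤ) ∣ W.Δ) (hA : (W.map (Int.castRingHom (ZMod p))).hasseCoeff p = 0)
    {u : ℕ → (maxNilIdealC F).toIdeal} (hup : ∀ n, AinfTop.mulPC F p W (u (n + 1)) = u n)
    {Q : W.Pt (AinfTop.nilTheta F p (surjective_fontaineTheta_integerC hp))}
    (hQ : AinfTop.thetaPt W (surjective_fontaineTheta_integerC hp) Q = ⟨u 0⟩)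
    (hQσ : ∀ σ : absoluteGaloisGroup F, AinfTop.galPtN W (surjective_fontaineTheta_integerC hp) σ Q = Q) :
    (bdRPeriodRingData (F := F) (p := p) hp).IsFilZeroCoboundary (rationalTateRep (AinfTop.curveF F W) p) fun σ =>
      ((1 : (bdRPeriodRingData (F := F) (p := p) hp).B) ⊗ₜ[ℚ_[p]]
        TateModule.toRational p ((AinfTop.tateGeomEquivTatePtSS F W p norm_natCast_C_lt_one' (by omega) hΔ hA).symm
          (AinfTop.kummerCocycle W u hup (AinfTop.galCBall_base_eq_of_fixedLift W hQ hQσ) σ)) :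
        (bdRPeriodRingData (F := F) (p := p) hp).B ⊗[ℚ_[p]] (AinfTop.curveF F W).rationalTateModule p) :=
  isFilZeroCoboundary_kummerCocycle_curveF hp W (by omega) hΔ hA
    (AinfTop.exists_omegaPeriodHom_not_mem_filOne_sq W hp5 hΔ hA) (AinfTop.exists_tatePt_mulDefectC_not_mem W (by omega) hΔ hA)
    hup hQ hQσ

/-- **UNCONDITIONAL, `ℚ_p`-rational base points** (`p ≥ 5`, good supersingular reduction): the Kummer cocycle of a `[p]`-division
sequence of the point of `Ŵ(pℤ_p)` with parameter `p·c` dies in `H¹(F, B_dR⁺ ⊗ V_pE)`.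
[cite: BlochKato1990, Ex. 3.10.1, (3.11.1)] [cite: Tate1967, §4] -/
theorem isFilZeroCoboundary_kummerCocycle_curveF_of_zp_of_five_le (W : WeierstrassCurve ℤ) [(AinfTop.curveF F W).IsElliptic]
    (hp5 : 5 ≤ p) (hΔ : ¬ (p : ℤ) ∣ W.Δ) (hA : (W.map (Int.castRingHom (ZMod p))).hasseCoeff p = 0)
    {u : ℕ → (maxNilIdealC F).toIdeal} (hup : ∀ n, AinfTop.mulPC F p W (u (n + 1)) = u n) (c : ℤ_[p])
    (hu0 : (u 0 : CBall F) = AinfTop.theta F p (AinfTop.of F p (zpToAinf ((p : ℤ_[p]) * c)))) :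
    ∃ hu₀ : ∀ σ : absoluteGaloisGroup F, galCBall σ (u 0 : CBall F) = u 0,
      (bdRPeriodRingData (F := F) (p := p) hp).IsFilZeroCoboundary (rationalTateRep (AinfTop.curveF F W) p) fun σ =>
        ((1 : (bdRPeriodRingData (F := F) (p := p) hp).B) ⊗ₜ[ℚ_[p]]
          TateModule.toRational p ((AinfTop.tateGeomEquivTatePtSS F W p norm_natCast_C_lt_one' (by omega) hΔ hA).symm
            (AinfTop.kummerCocycle W u hup hu₀ σ)) :
          (bdRPeriodRingData (F := F) (p := p) hp).B ⊗[ℚ_[p]] (AinfTop.curveF F W).rationalTateModule p) :=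
  isFilZeroCoboundary_kummerCocycle_curveF_of_zp hp W (by omega) hΔ hA
    (AinfTop.exists_omegaPeriodHom_not_mem_filOne_sq W hp5 hΔ hA) (AinfTop.exists_tatePt_mulDefectC_not_mem W (by omega) hΔ hA)
    hup c hu0

end Literature.NumberTheory.PAdicHodge

end
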